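import Summits.QuantumFields.BalabanUV.T4Continuum.Support.NE7MeanZeroGaugeSupPoincare
import HarnessLib

/-!
# NE7MeanZeroGaugeSupPoincareInBlock — THE SUP POINCARÉ LETTER OF `Ξ_Q(W)` WITH THE GRADIENT HYPOTHESIS ASKED ONLY INSIDE BLOCKS (memo ROAD-G100 §2.4 (iii)–(iv)):
# `bmeanIterW L (j+1) W ξ = 0`, `‖gaugeDir W ξ (y,μ)‖ ≤ G` on every bond with BOTH endpoints in one `M`-block ⟹ `sup‖ξ‖ ≤ (2d(M−1)∕(1 − θ))·G`

Cell `pub-balaban`, rung (B)+1 sub-cell t4, lineage `b2b-balaban-t4-ne7-p1`, generation 100 (CRUX PROVER NE7 #1 = OWNER of BINDER row NE7).  `NE7MeanZeroGaugeSupPoincare` (p762414) asks the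
gradient bound on ALL bonds; its proof (comb-gauge staircase along IN-BLOCK tree contours + the corner∕mean comparison + the nested∕single bridge) uses it only on bonds with both endpoints in
one block.  The spike-free slice split (`NE7NestedCovariantExtension.exists_fullGauge_split_of_dirIter_eq_gaugeDir`) produces `η ∈ Ξ_Q(W)` with `gaugeDir W η = Ỹ − T − gaugeDir W ζ₁`, and
`gaugeDir W ζ₁` (the nested covariant block-constant extension) is small ONLY inside blocks (it jumps by `O(‖ζ₁‖)` across block faces) — so the split needs exactly this in-block form to avoid an
`M²` in the size of the gauge function (memo §2.4 (iv)).  THIS FILE re-issues the five theorems of p762414 with the in-block hypothesis (and `0 ≤ G` displayed, since a one-site block has no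
in-block bond); proofs verbatim otherwise.
WHAT ([folklore]; 0 def, 0 sorry): `norm_comb_sub_corner_le_inBlock`, `norm_le_corner_add_inBlock`, `norm_bmeanW_sub_corner_le_inBlock`, `norm_le_of_bmeanIterW_eq_zero_inBlock`,
**`sup_le_of_bmeanIterW_eq_zero_inBlock`** (THE LETTER: `∀ y, ‖ξ y‖ ≤ (2d(M−1)∕(1 − θ))·G`, `θ = 4d²(M−1)²x + 16d·loopRad d L (prop1Radius^[j] x) + 4d(d−1)(M−1)²x < 1`).
HONEST FRAMING (page 1): covariant kinematics at ONE background in the cell's typed class; nothing of Bałaban's asserted; NOT the slice split, NOT (S1), NOT NE7; spine 0∕9; finite T⁴ rung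
(B)+1 — NOT infinite volume, NOT mass gap, NOT BetaPertH, NOT Clay.  Continuum YM on T⁴ ⇐ BetaPertH ∧ nine spine estimates (0/9 proved); BetaPertH ⇐ (D1) ∧ (D4) ∧ CAP+tail; G-an2-4 gates
asym, D1 and NE2/3/4.
-/

set_option autoImplicit false

open scoped BigOperators Matrix.Norms.L2Operator
open Finset

namespace Summit.QuantumFields.BalabanUV.T4Continuum.NE7MeanZeroGaugeSupPoincareInBlock

open Literature.MathematicalPhysics.QuantumFieldTheory.Balaban1983to89
open B7Prop1Explicit B7Prop2Explicit
open T4AveragingDeficitWall (IsUnitaryCfg SmallField Ad)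
open T4AveragingDeficitWallBoundary (periodBox mem_periodBox card_periodBox)
open T4AveragingDeficitNonAbelian (Ad_mul Ad_sub)
open AveragingDeficitTransport (norm_Ad_of_unitary mem_U1_of_unitary)
open AveragingDeficitNearIdentity (Ad_one norm_Ad_sub_le)
open AveragingDeficitTwoLevelPrep (prop1Radius)
open AveragingDeficitMultiLevelPrep (LevelSmall)
open AveragingDeficitBlockDensity (btree btree_mem)
open BlockAveragePushDirGauge (gaugeDir)
open NE3TangentNoGoWords (dPot asum_dPot)
open NE3CombGauge (btree_corner isUnitaryCfg_comb)
open NE3CombGaugeCharge (gaugeDir_gaugeAct_eq)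
open NE3CovariantSliceOrthogonality (gaugeDir_eq_neg_dPot_add_defect)
open NE3CovariantBlockPoincare (Ad_inv_Ad)
open NE3CovariantBlockMean (bmeanW bmeanIterW boxVec_bounds)
open NE3NestedBlockMeanCovariance (comb_nearOne bmeanW_eq_bmean_comb)
open NE3NestedBlockMeanBridge (norm_bmeanIterW_sub_bmeanW_le)
open NE3FramePotGauge (bmean)
open NE3SmoothRightInverseBounds (norm_asum_le_of_steps)
open SmoothRefineBlocks (blk res blk_add_res res_nonneg res_le steps mem_steps_treeWord)
open SpreadLift (loopRad)
open NE3CovariantLineSumsError (iterate_prop1Radius_nonneg)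
open PeriodicChoice (apply_wrap_eq wrap_mem_periodBox)
open NE7MeanZeroGaugeSupPoincare (l1_le_of_box)

noncomputable section

variable {d : ℕ} {n : Type*} [Fintype n] [DecidableEq n]

/-! ## The letters with the in-block gradient hypothesis -/

/-- **THE COVARIANT STAIRCASE FROM THE CORNER, IN-BLOCK HYPOTHESIS** (the gradient bound is asked only on bonds with both endpoints in a block):: for unitary `W` with `SmallField W a` (`a ≥ 0`), a site field `ξ` with `‖ξ y‖ ≤ S` and `‖gaugeDir W ξ y μ‖ ≤ G` everywhere, and a
site `x` of the block of `z` (`M•z ≤ x ≤ M•z + (M−1)𝟙`): the comb-dressed value at `x` differs from the corner value by at most `d(M−1)·(G + 2(d−1)(M−1)a·S)` — along the tree contour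
`Γ_{M•z, x}` every flat difference of `ξ̃ = Ad_{btree}ξ` is a transported covariant gradient plus the comb defect. [folklore] -/
theorem norm_comb_sub_corner_le_inBlock [Nonempty n] {M : ℕ} (hM : 1 ≤ M) {W : Site d → Fin d → (Matrix n n ℂ)ˣ} (hWu : IsUnitaryCfg W) {a : ℝ} (ha : 0 ≤ a)
    (hWa : SmallField W a) (ξ : Site d → Matrix n n ℂ) {S G : ℝ} (hS : ∀ y, ‖ξ y‖ ≤ S) (hG0 : 0 ≤ G)
    (hG : ∀ (z y : Site d) (μ : Fin d), (M : ℤ) • z ≤ y → (y + e μ ≤ (M : ℤ) • z + fun _ => (M : ℤ) - 1) → ‖gaugeDir W ξ y μ‖ ≤ G)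
    (z : Site d) {x : Site d} (hx : (M : ℤ) • z ≤ x) (hx' : x ≤ (M : ℤ) • z + fun _ => (M : ℤ) - 1) :
    ‖Ad (btree M W z x) (ξ x) - ξ ((M : ℤ) • z)‖ ≤ d * ((M : ℝ) - 1) * (G + 2 * (((d : ℝ) - 1) * ((M : ℝ) - 1) * a) * S) := by
  letI : CStarAlgebra (Matrix n n ℂ) := {}
  set ξt : Site d → Matrix n n ℂ := fun y => Ad (btree M W z y) (ξ y) with hξt
  have huu : ∀ y, btree M W z y ∈ unitaryUnits (Matrix n n ℂ) := fun y => btree_mem hWu M z y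
  have hM1r : (0 : ℝ) ≤ (M : ℝ) - 1 := sub_nonneg.mpr (by exact_mod_cast hM)
  -- the displacement `v = x − M•z` lies in the box
  set v : Site d := x - (M : ℤ) • z with hv
  have hv0 : ∀ i, 0 ≤ v i := fun i => by have := hx i; simp only [hv, Pi.sub_apply]; linarith
  have hv1 : ∀ i, v i ≤ (M : ℤ) - 1 := fun i => by
    have := hx' i; simp only [Pi.add_apply] at this; simp only [hv, Pi.sub_apply]; linarith
  have hxv : (M : ℤ) • z + v = x := by simp only [hv]; abel
  -- per-step bound on the tree contour
  have hback : (fun y => Ad (btree M W z y)⁻¹ (ξt y)) = ξ := by funext y; simp only [hξt]; exact Ad_inv_Ad _ _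
  have hstep : ∀ s ∈ steps ((M : ℤ) • z) (treeWord v), ‖stepA (dPot ξt) s.1 s.2‖ ≤ G + 2 * (((d : ℝ) - 1) * ((M : ℝ) - 1) * a) * S := by
    intro s hs
    obtain ⟨y, κ, rfl, hy, hy'⟩ := mem_steps_treeWord ((M : ℤ) • z) v hv0 s hs
    rw [stepA_true]
    have hy'' : y + e κ ≤ (M : ℤ) • z + (fun _ => (M : ℤ) - 1) :=
      fun i => (hy' i).trans (by simp only [Pi.add_apply]; linarith [hv1 i])
    -- `dPot ξ̃ = defect − transported covariant gradient`
    have hcov : gaugeDir (gaugeAct (btree M W z) W) ξt y κ = Ad (btree M W z (y + e κ)) (gaugeDir W ξ y κ) := by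
      rw [gaugeDir_gaugeAct_eq, hback]
    have hsplit : dPot ξt y κ
        = (Ad (gaugeAct (btree M W z) W y κ)⁻¹ (ξt y) - ξt y) - Ad (btree M W z (y + e κ)) (gaugeDir W ξ y κ) := by
      have h := gaugeDir_eq_neg_dPot_add_defect (gaugeAct (btree M W z) W) ξt y κ
      rw [hcov] at h
      rw [h]; abel
    have hg : gaugeAct (btree M W z) W y κ ∈ unitaryUnits (Matrix n n ℂ) := isUnitaryCfg_comb hWu M z y κ
    have hgi : (gaugeAct (btree M W z) W y κ)⁻¹ ∈ unitaryUnits (Matrix n n ℂ) := (unitaryUnits _).inv_mem hg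
    have hdef : ‖Ad (gaugeAct (btree M W z) W y κ)⁻¹ (ξt y) - ξt y‖ ≤ 2 * (((d : ℝ) - 1) * ((M : ℝ) - 1) * a) * S := by
      refine (norm_Ad_sub_le hgi (ξt y)).trans ?_
      have h1 : ‖(((gaugeAct (btree M W z) W y κ)⁻¹ : (Matrix n n ℂ)ˣ) : Matrix n n ℂ) - 1‖ ≤ ((d : ℝ) - 1) * ((M : ℝ) - 1) * a :=
        (norm_inv_sub_one_le (mem_U1_of_unitary hg)).trans (comb_nearOne hWu ha hWa z y κ hy hy'')
      have h2 : ‖ξt y‖ ≤ S := by simp only [hξt]; rw [norm_Ad_of_unitary (huu y)]; exact hS y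
      have h10 : 0 ≤ ((d : ℝ) - 1) * ((M : ℝ) - 1) * a := (norm_nonneg _).trans h1
      exact mul_le_mul (mul_le_mul_of_nonneg_left h1 (by norm_num)) h2 (norm_nonneg _) (mul_nonneg (by norm_num) h10)
    have hgr : ‖Ad (btree M W z (y + e κ)) (gaugeDir W ξ y κ)‖ ≤ G := by
      rw [norm_Ad_of_unitary (huu _)]
      exact hG z y κ hy hy''
    rw [hsplit]
    exact (norm_sub_le _ _).trans (by linarith)
  -- sum along the contour
  have hsum := norm_asum_le_of_steps (dPot ξt) (treeWord v) ((M : ℤ) • z) hstep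
  rw [asum_dPot, disp_treeWord, hxv, length_treeWord] at hsum
  have hcorner : ξt ((M : ℤ) • z) = ξ ((M : ℤ) • z) := by simp only [hξt]; rw [btree_corner, Ad_one]
  rw [hcorner] at hsum
  have hlen : ((l1 v : ℕ) : ℝ) ≤ d * ((M : ℝ) - 1) := l1_le_of_box v hv0 hv1
  by_cases hd : d = 0
  · subst hd
    have hl : l1 v = 0 := by simp [l1]
    rw [hl] at hsum
    simp only [Nat.cast_zero, zero_mul] at hsum ⊢
    exact hsum
  · have hd1 : (0 : ℝ) ≤ (d : ℝ) - 1 := by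
      have : (1 : ℝ) ≤ d := by exact_mod_cast Nat.one_le_iff_ne_zero.mpr hd
      linarith
    have hS0 : 0 ≤ S := (norm_nonneg _).trans (hS x)
    have hb : 0 ≤ G + 2 * (((d : ℝ) - 1) * ((M : ℝ) - 1) * a) * S := by
      have h1 : 0 ≤ ((d : ℝ) - 1) * ((M : ℝ) - 1) * a := mul_nonneg (mul_nonneg hd1 hM1r) ha
      have h2 : 0 ≤ ((d : ℝ) - 1) * ((M : ℝ) - 1) * a * S := mul_nonneg h1 hS0
      linarith
    exact hsum.trans (mul_le_mul_of_nonneg_right hlen hb)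

/-- (in-block hypothesis) … hence `‖ξ x‖ ≤ ‖ξ(M•z)‖ + d(M−1)·(G + 2(d−1)(M−1)a·S)` on the block of `z` (the dressing is an isometry). [folklore] -/
theorem norm_le_corner_add_inBlock [Nonempty n] {M : ℕ} (hM : 1 ≤ M) {W : Site d → Fin d → (Matrix n n ℂ)ˣ} (hWu : IsUnitaryCfg W) {a : ℝ} (ha : 0 ≤ a)
    (hWa : SmallField W a) (ξ : Site d → Matrix n n ℂ) {S G : ℝ} (hS : ∀ y, ‖ξ y‖ ≤ S) (hG0 : 0 ≤ G)
    (hG : ∀ (z y : Site d) (μ : Fin d), (M : ℤ) • z ≤ y → (y + e μ ≤ (M : ℤ) • z + fun _ => (M : ℤ) - 1) → ‖gaugeDir W ξ y μ‖ ≤ G)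
    (z : Site d) {x : Site d} (hx : (M : ℤ) • z ≤ x) (hx' : x ≤ (M : ℤ) • z + fun _ => (M : ℤ) - 1) :
    ‖ξ x‖ ≤ ‖ξ ((M : ℤ) • z)‖ + d * ((M : ℝ) - 1) * (G + 2 * (((d : ℝ) - 1) * ((M : ℝ) - 1) * a) * S) := by
  letI : CStarAlgebra (Matrix n n ℂ) := {}
  have h := norm_comb_sub_corner_le_inBlock hM hWu ha hWa ξ hS hG0 hG z hx hx'
  have hiso : ‖ξ x‖ = ‖Ad (btree M W z x) (ξ x)‖ := (norm_Ad_of_unitary (btree_mem hWu M z x) _).symm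
  rw [hiso]
  -- `‖A‖ ≤ ‖A − B‖ + ‖B‖`
  have h2 : ‖Ad (btree M W z x) (ξ x)‖ ≤ ‖Ad (btree M W z x) (ξ x) - ξ ((M : ℤ) • z)‖ + ‖ξ ((M : ℤ) • z)‖ := norm_le_norm_sub_add _ _
  linarith

/-- (in-block hypothesis) **`‖bmeanW M W ξ z − ξ(M•z)‖ ≤ d(M−1)·(G + 2(d−1)(M−1)a·S)`**: the transported mean is the flat mean of the comb-dressed field (`bmeanW_eq_bmean_comb`), and every
dressed block value is within the staircase bound of the corner value. [folklore] -/
theorem norm_bmeanW_sub_corner_le_inBlock [Nonempty n] {M : ℕ} (hM : 1 ≤ M) {W : Site d → Fin d → (Matrix n n ℂ)ˣ} (hWu : IsUnitaryCfg W) {a : ℝ} (ha : 0 ≤ a)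
    (hWa : SmallField W a) (ξ : Site d → Matrix n n ℂ) {S G : ℝ} (hS : ∀ y, ‖ξ y‖ ≤ S) (hG0 : 0 ≤ G)
    (hG : ∀ (z y : Site d) (μ : Fin d), (M : ℤ) • z ≤ y → (y + e μ ≤ (M : ℤ) • z + fun _ => (M : ℤ) - 1) → ‖gaugeDir W ξ y μ‖ ≤ G) (z : Site d) :
    ‖bmeanW M W ξ z - ξ ((M : ℤ) • z)‖ ≤ d * ((M : ℝ) - 1) * (G + 2 * (((d : ℝ) - 1) * ((M : ℝ) - 1) * a) * S) := by
  have e1 : bmeanW M W ξ z - ξ ((M : ℤ) • z)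
      = ∑ r : Fin d → Fin M, (((M : ℝ) ^ d)⁻¹ : ℝ) • (Ad (btree M W z ((M : ℤ) • z + boxVec M r)) (ξ ((M : ℤ) • z + boxVec M r)) - ξ ((M : ℤ) • z)) := by
    have hone : ξ ((M : ℤ) • z) = ∑ _r : Fin d → Fin M, (((M : ℝ) ^ d)⁻¹ : ℝ) • ξ ((M : ℤ) • z) := by
      rw [← Finset.sum_smul, sum_weights M hM, one_smul]
    rw [bmeanW_eq_bmean_comb]
    unfold bmean
    conv_lhs => rw [hone]
    rw [← Finset.sum_sub_distrib]
    refine Finset.sum_congr rfl fun r _ => ?_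
    rw [smul_sub]
  rw [e1]
  refine norm_avg_le M hM _ fun r => ?_
  have hb := boxVec_bounds M r
  exact norm_comb_sub_corner_le_inBlock hM hWu ha hWa ξ hS hG0 hG z (x := (M : ℤ) • z + boxVec M r)
    (fun i => by simp only [Pi.add_apply]; linarith [(hb i).1])
    (fun i => by simp only [Pi.add_apply]; linarith [Int.lt_iff_add_one_le.mp (hb i).2])

/-- **NESTED TRANSPORTED BLOCK MEAN ZERO ⟹ POINTWISE BOUND, IN-BLOCK HYPOTHESIS** (multi-level small-field class: `W` unitary, `0 ≤ x`, `LevelSmall d L j x`, `SmallField W x`, `M = L^{j+1}`): if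
`bmeanIterW L (j+1) W ξ = 0` and `‖ξ‖ ≤ S`, `‖gaugeDir W ξ‖ ≤ G` everywhere, then for every site `y`:
`‖ξ y‖ ≤ θ_b·S + 2·d(M−1)·(G + 2(d−1)(M−1)x·S)`, `θ_b = 4d²(M−1)²x + 16d·loopRad d L (prop1Radius^[j] x)` (the bridge constant). [folklore] -/
theorem norm_le_of_bmeanIterW_eq_zero_inBlock [Nonempty n] {L : ℕ} (hL : 2 ≤ L) (j : ℕ) {W : Site d → Fin d → (Matrix n n ℂ)ˣ} {x : ℝ}
    (hWu : IsUnitaryCfg W) (hx : 0 ≤ x) (hsm : LevelSmall d L j x) (hWx : SmallField W x)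
    (ξ : Site d → Matrix n n ℂ) (hm : bmeanIterW L (j + 1) W ξ = 0) {S G : ℝ} (hS : ∀ y, ‖ξ y‖ ≤ S) (hG0 : 0 ≤ G)
    (hG : ∀ (z y : Site d) (μ : Fin d), ((L ^ (j + 1) : ℕ) : ℤ) • z ≤ y → (y + e μ ≤ ((L ^ (j + 1) : ℕ) : ℤ) • z + fun _ => ((L ^ (j + 1) : ℕ) : ℤ) - 1) → ‖gaugeDir W ξ y μ‖ ≤ G) (y : Site d) :
    ‖ξ y‖ ≤ (4 * (d : ℝ) ^ 2 * ((L : ℝ) ^ (j + 1) - 1) ^ 2 * x + 16 * d * loopRad d L ((prop1Radius d L)^[j] x)) * S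
        + 2 * (d * (((L ^ (j + 1) : ℕ) : ℝ) - 1) * (G + 2 * (((d : ℝ) - 1) * (((L ^ (j + 1) : ℕ) : ℝ) - 1) * x) * S)) := by
  have hL1 : 1 ≤ L := le_trans (by norm_num) hL
  have hM1 : 1 ≤ L ^ (j + 1) := Nat.one_le_pow _ _ (by omega)
  -- the block of `y`
  have hy0 : ((L ^ (j + 1) : ℕ) : ℤ) • blk (L ^ (j + 1)) y ≤ y := fun i => by
    have h := congr_fun (blk_add_res (L ^ (j + 1)) y) i
    simp only [Pi.add_apply] at h
    have := res_nonneg hM1 y i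
    linarith
  have hy1 : y ≤ ((L ^ (j + 1) : ℕ) : ℤ) • blk (L ^ (j + 1)) y + (fun _ => ((L ^ (j + 1) : ℕ) : ℤ) - 1) := fun i => by
    have h := congr_fun (blk_add_res (L ^ (j + 1)) y) i
    simp only [Pi.add_apply] at h ⊢
    have := res_le hM1 y i
    linarith
  -- (1) staircase from the corner
  have h1 := norm_le_corner_add_inBlock hM1 hWu hx hWx ξ hS hG0 hG (blk (L ^ (j + 1)) y) hy0 hy1
  -- (2) corner versus the single-scale mean
  have h2 := norm_bmeanW_sub_corner_le_inBlock hM1 hWu hx hWx ξ hS hG0 hG (blk (L ^ (j + 1)) y)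
  -- (3) the single-scale mean versus the nested mean (= 0)
  have h3 := norm_bmeanIterW_sub_bmeanW_le hL j hWu hx hsm hWx ξ (blk (L ^ (j + 1)) y)
  rw [hm] at h3
  simp only [Pi.zero_apply, zero_sub, norm_neg] at h3
  have hS0 : 0 ≤ S := (norm_nonneg _).trans (hS y)
  have havg : ((((L ^ (j + 1) : ℕ) : ℝ) ^ d)⁻¹ * ∑ v ∈ periodBox (d := d) (L ^ (j + 1)), ‖ξ (((L ^ (j + 1) : ℕ) : ℤ) • blk (L ^ (j + 1)) y + v)‖) ≤ S := by
    have hMd : (0 : ℝ) < ((L ^ (j + 1) : ℕ) : ℝ) ^ d := by positivity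
    rw [inv_mul_le_iff₀ hMd]
    have hsum : ∑ v ∈ periodBox (d := d) (L ^ (j + 1)), ‖ξ (((L ^ (j + 1) : ℕ) : ℤ) • blk (L ^ (j + 1)) y + v)‖
        ≤ ∑ _v ∈ periodBox (d := d) (L ^ (j + 1)), S := Finset.sum_le_sum fun v _ => hS _
    have hcard : ∑ _v ∈ periodBox (d := d) (L ^ (j + 1)), S = ((L ^ (j + 1) : ℕ) : ℝ) ^ d * S := by
      rw [Finset.sum_const, card_periodBox, nsmul_eq_mul]; push_cast; ring
    linarith
  have hθ0 : 0 ≤ 4 * (d : ℝ) ^ 2 * ((L : ℝ) ^ (j + 1) - 1) ^ 2 * x + 16 * d * loopRad d L ((prop1Radius d L)^[j] x) := by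
    have hr : 0 ≤ (prop1Radius d L)^[j] x := iterate_prop1Radius_nonneg j hx
    have : 0 ≤ loopRad d L ((prop1Radius d L)^[j] x) := by unfold loopRad; positivity
    positivity
  have h3' : ‖bmeanW (L ^ (j + 1)) W ξ (blk (L ^ (j + 1)) y)‖
      ≤ (4 * (d : ℝ) ^ 2 * ((L : ℝ) ^ (j + 1) - 1) ^ 2 * x + 16 * d * loopRad d L ((prop1Radius d L)^[j] x)) * S :=
    h3.trans (mul_le_mul_of_nonneg_left havg hθ0)
  -- corner value
  have hcorner := norm_le_norm_sub_add (ξ (((L ^ (j + 1) : ℕ) : ℤ) • blk (L ^ (j + 1)) y)) (bmeanW (L ^ (j + 1)) W ξ (blk (L ^ (j + 1)) y))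
  rw [norm_sub_rev] at hcorner
  linarith

/-- **THE SUP POINCARÉ LETTER OF `Ξ_Q(W)`, IN-BLOCK HYPOTHESIS** (the form the spike-free split consumes: `gaugeDir W η = Ỹ − T − gaugeDir W ζ₁` is controlled only inside blocks).: in the multi-level small-field class (`W` unitary, `0 ≤ x`, `LevelSmall d L j x`, `SmallField W x`, `M = L^{j+1}`), for a `P`-periodic
(`P ≥ 1`) site field `ξ` with `bmeanIterW L (j+1) W ξ = 0` and `‖gaugeDir W ξ y μ‖ ≤ G` everywhere, IF the class constant
`θ := 4d²(M−1)²x + 16d·loopRad d L (prop1Radius^[j] x) + 4d(d−1)(M−1)²x` satisfies `θ < 1` (it is `O(b∕L²)` in the cell's class, k-free), THEN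
`‖ξ y‖ ≤ (2d(M−1)∕(1 − θ))·G` for every `y` — k-FREE, N-FREE. [folklore] -/
theorem sup_le_of_bmeanIterW_eq_zero_inBlock [Nonempty n] {L : ℕ} (hL : 2 ≤ L) (j : ℕ) {W : Site d → Fin d → (Matrix n n ℂ)ˣ} {x : ℝ}
    (hWu : IsUnitaryCfg W) (hx : 0 ≤ x) (hsm : LevelSmall d L j x) (hWx : SmallField W x)
    (ξ : Site d → Matrix n n ℂ) (hm : bmeanIterW L (j + 1) W ξ = 0) {P : ℕ} (hP : 1 ≤ P) (hξP : ∀ (y : Site d) (κ : Fin d), ξ (y + (P : ℤ) • e κ) = ξ y)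
    {G : ℝ} (hG0 : 0 ≤ G)
    (hG : ∀ (z y : Site d) (μ : Fin d), ((L ^ (j + 1) : ℕ) : ℤ) • z ≤ y → (y + e μ ≤ ((L ^ (j + 1) : ℕ) : ℤ) • z + fun _ => ((L ^ (j + 1) : ℕ) : ℤ) - 1) → ‖gaugeDir W ξ y μ‖ ≤ G)
    (hθ : 4 * (d : ℝ) ^ 2 * ((L : ℝ) ^ (j + 1) - 1) ^ 2 * x + 16 * d * loopRad d L ((prop1Radius d L)^[j] x)
        + 4 * d * ((d : ℝ) - 1) * ((L : ℝ) ^ (j + 1) - 1) ^ 2 * x < 1) (y : Site d) :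
    ‖ξ y‖ ≤ 2 * d * ((L : ℝ) ^ (j + 1) - 1)
        / (1 - (4 * (d : ℝ) ^ 2 * ((L : ℝ) ^ (j + 1) - 1) ^ 2 * x + 16 * d * loopRad d L ((prop1Radius d L)^[j] x)
            + 4 * d * ((d : ℝ) - 1) * ((L : ℝ) ^ (j + 1) - 1) ^ 2 * x)) * G := by
  -- the sup over the period box is attained and bounds `ξ` everywhere
  have hne : (periodBox (d := d) P).Nonempty := ⟨_, wrap_mem_periodBox P hP 0⟩
  obtain ⟨y₀, -, hy₀⟩ := Finset.exists_max_image (periodBox (d := d) P) (fun y => ‖ξ y‖) hne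
  have hS : ∀ y, ‖ξ y‖ ≤ ‖ξ y₀‖ := fun y => by
    rw [← apply_wrap_eq (g := ξ) hξP y]
    exact hy₀ _ (wrap_mem_periodBox P hP y)
  -- the pointwise bound at the maximiser
  have hmain := norm_le_of_bmeanIterW_eq_zero_inBlock hL j hWu hx hsm hWx ξ hm hS hG0 hG y₀
  have hMr : ((L ^ (j + 1) : ℕ) : ℝ) = (L : ℝ) ^ (j + 1) := by push_cast; rfl
  rw [hMr] at hmain
  set θb : ℝ := 4 * (d : ℝ) ^ 2 * ((L : ℝ) ^ (j + 1) - 1) ^ 2 * x + 16 * d * loopRad d L ((prop1Radius d L)^[j] x) with hθb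
  set m1 : ℝ := (L : ℝ) ^ (j + 1) - 1 with hm1
  have h1θ : 0 < 1 - (θb + 4 * d * ((d : ℝ) - 1) * m1 ^ 2 * x) := by linarith
  -- `S ≤ θ·S + 2d(M−1)·G` at the maximiser, then absorb
  have hSle : ‖ξ y₀‖ ≤ (θb + 4 * d * ((d : ℝ) - 1) * m1 ^ 2 * x) * ‖ξ y₀‖ + 2 * d * m1 * G := by
    have e : θb * ‖ξ y₀‖ + 2 * (d * m1 * (G + 2 * (((d : ℝ) - 1) * m1 * x) * ‖ξ y₀‖))
        = (θb + 4 * d * ((d : ℝ) - 1) * m1 ^ 2 * x) * ‖ξ y₀‖ + 2 * d * m1 * G := by ring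
    rw [← e]; exact hmain
  have hSbound : ‖ξ y₀‖ ≤ 2 * d * m1 / (1 - (θb + 4 * d * ((d : ℝ) - 1) * m1 ^ 2 * x)) * G := by
    rw [div_mul_eq_mul_div, le_div_iff₀ h1θ]
    have e2 : ‖ξ y₀‖ * (1 - (θb + 4 * d * ((d : ℝ) - 1) * m1 ^ 2 * x))
        = ‖ξ y₀‖ - (θb + 4 * d * ((d : ℝ) - 1) * m1 ^ 2 * x) * ‖ξ y₀‖ := by ring
    rw [e2]
    linarith
  exact (hS y).trans hSbound

end

end Summit.QuantumFields.BalabanUV.T4Continuum.NE7MeanZeroGaugeSupPoincareInBlock
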